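import Summits.Ventures.LatticeQCDFlow.Scaling.SwapGraphDilution
import Summits.Ventures.LatticeQCDFlow.Scaling.HubProposalLaw
import Summits.Ventures.LatticeQCDFlow.Scaling.OneSidedHubRateLaw

/-!
HONEST FRAMING: exact (Metropolis-corrected) sampling algorithms for lattice gauge theory; figures
of merit are autocorrelation/cost numbers at stated couplings and volumes; no continuum-physics
claim.

# SwapGraphRateLaw — THE RATE CARD OF THE HOT-ONLY EXCHANGE SCHEME ON ANY SWAP GRAPH: FLOOR
# `p·min{t·c/(6m), γ₀(1−t)/(14K)}`; CEILINGS `t·h·min{μ_0(A),μ_0(Aᶜ)}/(mKv)` (DILUTED HANDOVER), `t·deg(k)/(2mv)`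
# (LEAST-CONNECTED REPLICA), `(1−t)Q_0(A,Aᶜ)/((K+1)v)` (TUNNELLING); AND THE SWAP FRACTION: FOR EVERY `t` THE GAP IS
# BELOW THE HARMONIC COMBINATION `ab/(a+b)` OF THE SWAP AND TUNNELLING THROUGHPUTS, WHILE THE BALANCED `t` ATTAINS
# `p·a′b′/(a′+b′)` (lean-2 GEN-23, ours)

Venture-side (OURS).  Cell `lqcd-flow` (pub-lqcd), unit `pub-lqcd-lean-2-g23`, 2026-08-26.  Chapter K, file 3: the
summary of `Scaling/SwapGraphDilution` (K1) and `Scaling/HubProposalLaw` (K2) in the format of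
`Scaling/OneSidedHubRateLaw` (J13), for the scheme `P = t·ptGraphSwap μ e 1 + (1−t)·prodKernel 𝟙_{k=0} M` on an
arbitrary edge list `e` of `m` entries (distinct endpoints, identity maps) listing every hub edge `(0, k+1)` at least
`c ≥ 1` times; `h` = entries touching level `0`, `deg(k)` = entries touching level `k`; one-sided domination
`p·μ_{k+1} ≤ μ_0`; hot update `μ_0`-reversible with Poincaré constant `γ₀`; a set `A` with `μ_k(A)μ_k(Aᶜ) ≥ v > 0`.

## What is proved

* §1 **`hotOnlyGraph_spectralGap_le_tunneling`** — for EVERY edge list with identity maps and hot-only updates,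
  `Gap ≤ (1−t)·Q_0(A,Aᶜ)/((K+1)·v)` (J13's tunnelling ceiling is graph-independent).
* §2 **`hotOnlyGraph_rateLaw`** — floor `p·min{t·c/(6m), γ₀(1−t)/(14K)}` ∧ diluted handover
  `t·h·min{μ_0(A),μ_0(Aᶜ)}/(m·K·v)` ∧ least-connected replica `t·deg(k+1)/(2m·v)` for every cold level ∧ tunnelling
  `(1−t)Q_0(A,Aᶜ)/((K+1)v)` with `γ₀μ_0(A)μ_0(Aᶜ) ≤ Q_0(A,Aᶜ)`.
* §3 THE SWAP FRACTION.  `min_mul_le_harmonic` (`min{ta, (1−t)b} ≤ ab/(a+b)` for `a, b > 0`, any `t`) and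
  `min_mul_balanced` (equality at `t = b/(a+b)`); **`hotOnlyGraph_spectralGap_le_harmonic`** — FOR EVERY `t`:
  `Gap ≤ ab/(a+b)` with `a = h·min{μ_0(A),μ_0(Aᶜ)}/(mKv)` (swap throughput) and `b = Q_0(A,Aᶜ)/((K+1)v)` (tunnelling
  throughput); **`hotOnlyGraph_spectralGap_ge_balanced`** — AT `t⋆ = b′/(a′+b′)` with `a′ = c/(6m)`, `b′ = γ₀/(14K)`:
  `Gap ≥ p·a′b′/(a′+b′)`.  Tuning the swap fraction buys the harmonic mean of the two throughputs and no more.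

Reading (no numerics implied): on any swap graph the hot-only exchange scheme is pinned by four numbers — how often the
rarest hub edge is proposed (`c/m`), how often any hub edge is (`h/m`), how fast the hot replica tunnels (`γ₀`,
`Q_0`), and how many replicas wait (`K`) —; the split `t` between swapping and updating can only trade the first
two against the third, harmonically.  NOT CLAIMED: maps (the star case with maps is `Scaling/FlowHubRateLaw`); cold
replicas that relax within sectors; continuous spaces; anything measured.  Literature grade (cell rule): OWN
COMPOSITION of K1/K2/J13; nothing cited as a fact; no new bib keys.
-/

noncomputable section

open Finset Function
open Literature.Probability.MarkovChains

namespace Summit.Ventures.LatticeQCDFlow.Scaling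

variable {S : Type*} [Fintype S] [DecidableEq S] {K m : ℕ} {μ : Fin (K + 1) → S → ℝ}
  {M : Fin (K + 1) → S → S → ℝ} {t : ℝ} {e : Fin m → Fin (K + 1) × Fin (K + 1)}

/-! ## §1 The tunnelling ceiling is graph-independent -/

/-- **THE TUNNELLING CEILING ON ANY SWAP GRAPH:** identity maps, every update on the hot replica, `μ_k(A)μ_k(Aᶜ) ≥ v > 0`
for all `k`: `Gap(P) ≤ (1−t)·Q_0(A,Aᶜ)/((K+1)·v)` — whatever pairs are exchanged, fresh sector labels are minted only
by the hot update (`0 ≤ t ≤ 1`, `|S| ≥ 2`, distinct endpoints; no domination hypothesis). [ours] -/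
theorem hotOnlyGraph_spectralGap_le_tunneling [Nontrivial S] (he : ∀ r, (e r).1 ≠ (e r).2) (hμ : ∀ k x, 0 < μ k x)
    (hμ1 : ∀ k, ∑ u, μ k u = 1) (hM : ∀ k, IsRowStochastic (M k)) (hMrev : ∀ k, DetailedBalance (μ k) (M k))
    (ht0 : 0 ≤ t) (ht1 : t ≤ 1) {A : Finset S} {v : ℝ} (hvpos : 0 < v)
    (hv : ∀ k : Fin (K + 1), v ≤ (∑ u ∈ A, μ k u) * ∑ u ∈ Aᶜ, μ k u) :
    spectralGap (tensorFun μ) (fun x y : Fin (K + 1) → S =>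
        t * ptGraphSwap μ e (fun _ : Fin m => Equiv.refl S) x y
          + (1 - t) * prodKernel (fun k : Fin (K + 1) => if k = 0 then (1 : ℝ) else 0) M x y)
      ≤ (1 - t) * edgeMeasure (μ 0) (M 0) A Aᶜ / (((K : ℝ) + 1) * v) := by
  have hw0 : ∀ k : Fin (K + 1), 0 ≤ (if k = 0 then (1 : ℝ) else 0) := fun k => by positivity
  have hQ := ptGraphSwap_isRowStochastic (e := e) (φ := fun _ : Fin m => Equiv.refl S) hμ
  have hQrev := ptGraphSwap_detailedBalance (e := e) (φ := fun _ : Fin m => Equiv.refl S) hμ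
  have hQA := ptGraphSwap_one_sectorCount_eq (e := e) he hμ A
  have hVge := allSectorMass_ge (μ := μ) hv
  have hVpos : 0 < ∑ k : Fin (K + 1), (∑ u ∈ A, μ k u) * ∑ u ∈ Aᶜ, μ k u :=
    lt_of_lt_of_le (mul_pos (by positivity) hvpos) hVge
  have h := weightedScheme_spectralGap_le_sectorCount (w := fun k : Fin (K + 1) => if k = 0 then (1 : ℝ) else 0)
    hμ hμ1 hM hMrev hw0 hotOnlyWeight_sum ht0 ht1 hQ hQrev hQA hVpos
  have hsum : ∑ k : Fin (K + 1), (if k = 0 then (1 : ℝ) else 0) * edgeMeasure (μ k) (M k) A Aᶜ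
      = edgeMeasure (μ 0) (M 0) A Aᶜ := by
    rw [Finset.sum_eq_single (0 : Fin (K + 1)) (fun k _ hk => by rw [if_neg hk, zero_mul])
      (fun h => absurd (mem_univ _) h), if_pos rfl, one_mul]
  rw [hsum] at h
  have hnum : 0 ≤ (1 - t) * edgeMeasure (μ 0) (M 0) A Aᶜ :=
    mul_nonneg (by linarith) (edgeMeasure_nonneg (fun u => (hμ 0 u).le) (hM 0).1 A Aᶜ)
  exact h.trans (div_le_div_of_nonneg_left hnum (by positivity) hVge)

/-! ## §2 The rate card -/

/-- **THE RATE CARD OF THE HOT-ONLY SCHEME ON A SWAP GRAPH** (`K, m ≥ 1`, `|S| ≥ 2`, `0 < t < 1`, `0 < p ≤ 1`, every hub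
edge listed `≥ c ≥ 1` times, identity maps, one-sided domination, hot Poincaré constant `γ₀`, `μ_k(A)μ_k(Aᶜ) ≥ v > 0`
for all `k`):
**floor** `p·min{t·c/(6m), γ₀(1−t)/(14K)} ≤ Gap`;
**diluted handover** `Gap ≤ t·h·min{μ_0(A), μ_0(Aᶜ)}/(m·K·v)`;
**least-connected replica** `Gap ≤ t·deg(k+1)/(2m·v)` for every cold level `k+1`;
**tunnelling** `Gap ≤ (1−t)·Q_0(A,Aᶜ)/((K+1)·v)`, and `γ₀·μ_0(A)μ_0(Aᶜ) ≤ Q_0(A,Aᶜ)`. [ours] -/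
theorem hotOnlyGraph_rateLaw [Nontrivial S] (hK : 1 ≤ K) (hm : 1 ≤ m) (he : ∀ r, (e r).1 ≠ (e r).2) {c : ℕ}
    (hc : ∀ k : Fin K, c ≤ (univ.filter (fun r : Fin m => e r = ((0 : Fin (K + 1)), k.succ))).card) (hc1 : 1 ≤ c)
    (hμ : ∀ k x, 0 < μ k x) (hμ1 : ∀ k, ∑ u, μ k u = 1) (hM : ∀ k, IsRowStochastic (M k))
    (hMrev : ∀ k, DetailedBalance (μ k) (M k)) (ht0 : 0 < t) (ht1 : t < 1) {p γ₀ : ℝ} (hp : 0 < p) (hp1 : p ≤ 1)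
    (hγ₀ : 0 < γ₀) (hdom : ∀ (k : Fin K) (u : S), p * μ k.succ u ≤ μ 0 u)
    (hgap0 : ∀ g : S → ℝ, γ₀ * lawVariance (μ 0) g ≤ dirichletForm (μ 0) (M 0) g) {A : Finset S} {v : ℝ}
    (hvpos : 0 < v) (hv : ∀ k : Fin (K + 1), v ≤ (∑ u ∈ A, μ k u) * ∑ u ∈ Aᶜ, μ k u) :
    p * min (t * c / (6 * m)) (γ₀ * (1 - t) / (14 * K))
        ≤ spectralGap (tensorFun μ) (fun x y : Fin (K + 1) → S =>
            t * ptGraphSwap μ e (fun _ : Fin m => Equiv.refl S) x y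
              + (1 - t) * prodKernel (fun k : Fin (K + 1) => if k = 0 then (1 : ℝ) else 0) M x y)
      ∧ spectralGap (tensorFun μ) (fun x y : Fin (K + 1) → S =>
            t * ptGraphSwap μ e (fun _ : Fin m => Equiv.refl S) x y
              + (1 - t) * prodKernel (fun k : Fin (K + 1) => if k = 0 then (1 : ℝ) else 0) M x y)
          ≤ t * ((univ.filter fun r : Fin m => (e r).1 = 0 ∨ (e r).2 = 0).card : ℝ)
              * min (∑ u ∈ A, μ 0 u) (∑ u ∈ Aᶜ, μ 0 u) / (m * K * v)
      ∧ (∀ k : Fin K, spectralGap (tensorFun μ) (fun x y : Fin (K + 1) → S =>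
            t * ptGraphSwap μ e (fun _ : Fin m => Equiv.refl S) x y
              + (1 - t) * prodKernel (fun k : Fin (K + 1) => if k = 0 then (1 : ℝ) else 0) M x y)
          ≤ t * ((univ.filter fun r : Fin m => (e r).1 = k.succ ∨ (e r).2 = k.succ).card : ℝ) / (2 * m * v))
      ∧ (spectralGap (tensorFun μ) (fun x y : Fin (K + 1) → S =>
            t * ptGraphSwap μ e (fun _ : Fin m => Equiv.refl S) x y
              + (1 - t) * prodKernel (fun k : Fin (K + 1) => if k = 0 then (1 : ℝ) else 0) M x y)
          ≤ (1 - t) * edgeMeasure (μ 0) (M 0) A Aᶜ / (((K : ℝ) + 1) * v)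
        ∧ γ₀ * ((∑ u ∈ A, μ 0 u) * ∑ u ∈ Aᶜ, μ 0 u) ≤ edgeMeasure (μ 0) (M 0) A Aᶜ) := by
  have hmpos : (0 : ℝ) < m := Nat.cast_pos.mpr (by omega)
  have hw0 : ∀ k : Fin (K + 1), 0 ≤ (if k = 0 then (1 : ℝ) else 0) := fun k => by positivity
  have hidle : ∀ k : Fin (K + 1), k ≠ 0 → (if k = 0 then (1 : ℝ) else 0) * edgeMeasure (μ k) (M k) A Aᶜ = 0 :=
    fun k hk => by rw [if_neg hk, zero_mul]
  refine ⟨?_, ?_, fun k => ?_, ⟨hotOnlyGraph_spectralGap_le_tunneling he hμ hμ1 hM hMrev ht0.le ht1.le hvpos hv,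
    hot_poincare_le_exitFlow (hμ1 0) (hM 0) (hMrev 0) hgap0 A⟩⟩
  · have h := multiHub_spectralGap_ge (e := e) (w := fun i : Fin (K + 1) => if i = 0 then (1 : ℝ) else 0) hK hm he
      hc hc1 hμ hμ1 hM hMrev hw0 hotOnlyWeight_sum (by simp) ht0 ht1 hp hp1 hγ₀ hdom hgap0
    simpa using h
  · exact dilutedHandover_spectralGap_le (φ := fun _ : Fin m => Equiv.refl S) hK hm he hμ hμ1 hM hMrev hw0
      hotOnlyWeight_sum ht0.le ht1.le (fun _ _ => Iff.rfl) hvpos (fun k _ => hv k) hidle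
  · have hAk : 0 < (∑ u ∈ A, μ k.succ u) * ∑ u ∈ Aᶜ, μ k.succ u := lt_of_lt_of_le hvpos (hv k.succ)
    have h := leastConnected_spectralGap_le (t := t) (M := M) (e := e) (φ := fun _ : Fin m => Equiv.refl S)
      (w := fun i : Fin (K + 1) => if i = 0 then (1 : ℝ) else 0) hm he hμ hμ1 hM hMrev hw0 hotOnlyWeight_sum ht0.le
      ht1.le (fun _ _ => Iff.rfl) k.succ hAk (hidle k.succ (Fin.succ_ne_zero k))
    refine h.trans (div_le_div_of_nonneg_left (by positivity) (by positivity) ?_)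
    exact mul_le_mul_of_nonneg_left (hv k.succ) (by positivity)

/-! ## §3 The swap fraction -/

/-- **`min{s·a, (1−s)·b} ≤ ab/(a+b)`** for `a, b > 0` (and every real `s`). [ours] -/
theorem min_mul_le_harmonic {a b s : ℝ} (ha : 0 < a) (hb : 0 < b) :
    min (s * a) ((1 - s) * b) ≤ a * b / (a + b) := by
  have hab : 0 < a + b := add_pos ha hb
  by_cases h : s * (a + b) ≤ b
  · refine (min_le_left _ _).trans ?_
    rw [le_div_iff₀ hab]
    nlinarith
  · push Not at h
    refine (min_le_right _ _).trans ?_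
    rw [le_div_iff₀ hab]
    nlinarith

/-- **The balanced fraction attains it:** at `t = b/(a+b)`, `t·a = (1−t)·b = ab/(a+b)`. [ours] -/
theorem min_mul_balanced {a b : ℝ} (ha : 0 < a) (hb : 0 < b) :
    min (b / (a + b) * a) ((1 - b / (a + b)) * b) = a * b / (a + b) := by
  have hab : (a + b) ≠ 0 := (add_pos ha hb).ne'
  have e1 : b / (a + b) * a = a * b / (a + b) := by field_simp
  have e2 : (1 - b / (a + b)) * b = a * b / (a + b) := by field_simp; ring
  rw [e1, e2, min_self]

/-- **FOR EVERY SWAP FRACTION the gap is below the harmonic combination of the two throughputs:** with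
`a = h·min{μ_0(A), μ_0(Aᶜ)}/(m·K·v)` (swap) and `b = Q_0(A,Aᶜ)/((K+1)·v)` (tunnelling), `Gap(P_t) ≤ a·b/(a+b)` for all
`0 ≤ t ≤ 1` (hot-only updates, identity maps, any edge list with `h ≥ 1` entries at the hot level, `μ_0(A), μ_0(Aᶜ) > 0`,
`Q_0(A,Aᶜ) > 0`). [ours] -/
theorem hotOnlyGraph_spectralGap_le_harmonic [Nontrivial S] (hK : 1 ≤ K) (hm : 1 ≤ m) (he : ∀ r, (e r).1 ≠ (e r).2)
    (hh : 1 ≤ (univ.filter fun r : Fin m => (e r).1 = 0 ∨ (e r).2 = 0).card) (hμ : ∀ k x, 0 < μ k x)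
    (hμ1 : ∀ k, ∑ u, μ k u = 1) (hM : ∀ k, IsRowStochastic (M k)) (hMrev : ∀ k, DetailedBalance (μ k) (M k))
    (ht0 : 0 ≤ t) (ht1 : t ≤ 1) {A : Finset S} (hA0 : 0 < min (∑ u ∈ A, μ 0 u) (∑ u ∈ Aᶜ, μ 0 u))
    (hQ0 : 0 < edgeMeasure (μ 0) (M 0) A Aᶜ) {v : ℝ} (hvpos : 0 < v)
    (hv : ∀ k : Fin (K + 1), v ≤ (∑ u ∈ A, μ k u) * ∑ u ∈ Aᶜ, μ k u) :
    spectralGap (tensorFun μ) (fun x y : Fin (K + 1) → S =>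
        t * ptGraphSwap μ e (fun _ : Fin m => Equiv.refl S) x y
          + (1 - t) * prodKernel (fun k : Fin (K + 1) => if k = 0 then (1 : ℝ) else 0) M x y)
      ≤ (((univ.filter fun r : Fin m => (e r).1 = 0 ∨ (e r).2 = 0).card : ℝ) * min (∑ u ∈ A, μ 0 u) (∑ u ∈ Aᶜ, μ 0 u)
            / (m * K * v)) * (edgeMeasure (μ 0) (M 0) A Aᶜ / (((K : ℝ) + 1) * v))
        / (((univ.filter fun r : Fin m => (e r).1 = 0 ∨ (e r).2 = 0).card : ℝ) * min (∑ u ∈ A, μ 0 u) (∑ u ∈ Aᶜ, μ 0 u)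
            / (m * K * v) + edgeMeasure (μ 0) (M 0) A Aᶜ / (((K : ℝ) + 1) * v)) := by
  have hKpos : (0 : ℝ) < K := Nat.cast_pos.mpr (by omega)
  have hmpos : (0 : ℝ) < m := Nat.cast_pos.mpr (by omega)
  have hhpos : (0 : ℝ) < ((univ.filter fun r : Fin m => (e r).1 = 0 ∨ (e r).2 = 0).card : ℝ) := by exact_mod_cast hh
  have hw0 : ∀ k : Fin (K + 1), 0 ≤ (if k = 0 then (1 : ℝ) else 0) := fun k => by positivity
  have hidle : ∀ k : Fin (K + 1), k ≠ 0 → (if k = 0 then (1 : ℝ) else 0) * edgeMeasure (μ k) (M k) A Aᶜ = 0 :=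
    fun k hk => by rw [if_neg hk, zero_mul]
  set a := ((univ.filter fun r : Fin m => (e r).1 = 0 ∨ (e r).2 = 0).card : ℝ) * min (∑ u ∈ A, μ 0 u) (∑ u ∈ Aᶜ, μ 0 u)
    / (m * K * v) with ha_def
  set b := edgeMeasure (μ 0) (M 0) A Aᶜ / (((K : ℝ) + 1) * v) with hb_def
  have ha : 0 < a := by positivity
  have hb : 0 < b := by positivity
  have h1 := dilutedHandover_spectralGap_le (φ := fun _ : Fin m => Equiv.refl S) hK hm he hμ hμ1 hM hMrev hw0
    hotOnlyWeight_sum ht0 ht1 (fun _ _ => Iff.rfl) hvpos (fun k _ => hv k) hidle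
  have h2 := hotOnlyGraph_spectralGap_le_tunneling (e := e) he hμ hμ1 hM hMrev ht0 ht1 hvpos hv
  have h1' : spectralGap (tensorFun μ) (fun x y : Fin (K + 1) → S =>
      t * ptGraphSwap μ e (fun _ : Fin m => Equiv.refl S) x y
        + (1 - t) * prodKernel (fun k : Fin (K + 1) => if k = 0 then (1 : ℝ) else 0) M x y) ≤ t * a := by
    rw [ha_def]; convert h1 using 1; ring
  have h2' : spectralGap (tensorFun μ) (fun x y : Fin (K + 1) → S =>
      t * ptGraphSwap μ e (fun _ : Fin m => Equiv.refl S) x y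
        + (1 - t) * prodKernel (fun k : Fin (K + 1) => if k = 0 then (1 : ℝ) else 0) M x y) ≤ (1 - t) * b := by
    rw [hb_def]; convert h2 using 1; ring
  exact (le_min h1' h2').trans (min_mul_le_harmonic ha hb)

/-- **THE BALANCED SWAP FRACTION ATTAINS THE HARMONIC FLOOR:** with `a′ = c/(6m)` and `b′ = γ₀/(14K)`, at
`t⋆ = b′/(a′+b′)` the floor of `hotOnlyGraph_rateLaw` reads `Gap(P_{t⋆}) ≥ p·a′b′/(a′+b′)`. [ours] -/
theorem hotOnlyGraph_spectralGap_ge_balanced [Nontrivial S] (hK : 1 ≤ K) (hm : 1 ≤ m) (he : ∀ r, (e r).1 ≠ (e r).2)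
    {c : ℕ} (hc : ∀ k : Fin K, c ≤ (univ.filter (fun r : Fin m => e r = ((0 : Fin (K + 1)), k.succ))).card)
    (hc1 : 1 ≤ c) (hμ : ∀ k x, 0 < μ k x) (hμ1 : ∀ k, ∑ u, μ k u = 1) (hM : ∀ k, IsRowStochastic (M k))
    (hMrev : ∀ k, DetailedBalance (μ k) (M k)) {p γ₀ : ℝ} (hp : 0 < p) (hp1 : p ≤ 1) (hγ₀ : 0 < γ₀)
    (hdom : ∀ (k : Fin K) (u : S), p * μ k.succ u ≤ μ 0 u)
    (hgap0 : ∀ g : S → ℝ, γ₀ * lawVariance (μ 0) g ≤ dirichletForm (μ 0) (M 0) g) :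
    p * ((c / (6 * m)) * (γ₀ / (14 * K)) / (c / (6 * m) + γ₀ / (14 * K)))
      ≤ spectralGap (tensorFun μ) (fun x y : Fin (K + 1) → S =>
          (γ₀ / (14 * K)) / (c / (6 * m) + γ₀ / (14 * K)) * ptGraphSwap μ e (fun _ : Fin m => Equiv.refl S) x y
            + (1 - (γ₀ / (14 * K)) / (c / (6 * m) + γ₀ / (14 * K)))
              * prodKernel (fun k : Fin (K + 1) => if k = 0 then (1 : ℝ) else 0) M x y) := by
  have hKpos : (0 : ℝ) < K := Nat.cast_pos.mpr (by omega)
  have hmpos : (0 : ℝ) < m := Nat.cast_pos.mpr (by omega)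
  have hcpos : (0 : ℝ) < c := Nat.cast_pos.mpr (by omega)
  set a' : ℝ := c / (6 * m) with ha'
  set b' : ℝ := γ₀ / (14 * K) with hb'
  have ha'pos : 0 < a' := by positivity
  have hb'pos : 0 < b' := by positivity
  have hsum : 0 < a' + b' := add_pos ha'pos hb'pos
  have ht0 : 0 < b' / (a' + b') := div_pos hb'pos hsum
  have ht1 : b' / (a' + b') < 1 := by rw [div_lt_one hsum]; linarith
  have hw0 : ∀ k : Fin (K + 1), 0 ≤ (if k = 0 then (1 : ℝ) else 0) := fun k => by positivity
  have h := multiHub_spectralGap_ge (e := e) (t := b' / (a' + b'))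
    (w := fun i : Fin (K + 1) => if i = 0 then (1 : ℝ) else 0) hK hm he hc hc1 hμ hμ1 hM hMrev hw0 hotOnlyWeight_sum
    (by simp) ht0 ht1 hp hp1 hγ₀ hdom hgap0
  simp only [if_true, mul_one] at h
  refine le_trans (le_of_eq ?_) h
  have e1 : b' / (a' + b') * c / (6 * m) = b' / (a' + b') * a' := by rw [ha']; ring
  have e2 : γ₀ * (1 - b' / (a' + b')) / (14 * K) = (1 - b' / (a' + b')) * b' := by rw [hb']; ring
  rw [e1, e2, min_mul_balanced ha'pos hb'pos]

end Summit.Ventures.LatticeQCDFlow.Scaling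

end
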